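import Summits.AtomisticToContinuum.HydrodynamicLimit.Theorems.ImplosionDichotomyPolynomialCompressionEosRatioAnalytic
import Summits.AtomisticToContinuum.HydrodynamicLimit.Theorems.ImplosionDichotomyPolynomialCompressionEosRatioUniform
import Summits.AtomisticToContinuum.HydrodynamicLimit.Theorems.ImplosionDichotomyPolynomialCompressionEosCesaro
import Summits.AtomisticToContinuum.HydrodynamicLimit.Theorems.ImplosionDichotomyPolynomialCompressionEosAssembly

/-!
# The hard-sphere equation of state at low density — `ImplosionDichotomy.HsEosLowDensity` PROVED

Route support item stmt-AtomisticToContinuum-0768 (`HsEosLowDensity`, wanted by `ImplosionDichotomy` and twelve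
other routes of `AtomisticToContinuum/HydrodynamicLimit`): there are `η₀ > 0` and `F` real-analytic on
`(−η₀, η₀)` with `hsExcessFreeEnergy = F` on `[0, η₀)`, `F 0 = 0`, `F′(0) = 2π/3` (the second virial coefficient
of unit-diameter spheres), and the canonical thermodynamic limit `−N⁻¹ log hsFreeVolume η N → F(η)` exists for
`η ∈ [0, η₀)` (Ruelle 1969 §3.4; Lebowitz–Penrose 1964).

This file is the glue of the four equation-of-state stubs of the line `log-lipschitz-budget` on the crux
`ImplosionDichotomy.PolynomialCompression` (stmt-12587), all landed as Theorems files: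
* `stub_eosRatioAnalytic` (E1): the analytic insertion factor `Rf = 1/Φ∘ψ⁻¹`, `Φ(u) = Σ_j bE j uʲ/j!`,
  `ψ(u) = uΦ(u)`, with `Rf 0 = 1`, `Rf′(0) = −bE 1 = 4π/3`, the functional equation `Rf x · Φ(x Rf x) = 1`,
  bounds, Lipschitz, uniqueness of the root;
* `stub_eosRatioUniform` (E2a): the insertion ratios `q_N(m) = Ξ_N(m)/Ξ_N(m+1)` of `N + 1` uniform hard spheres
  of diameter `η^{1/3}(N+1)^{−1/3}` on `𝕋³` converge to `Rf(η m/(N+1))` uniformly in the level `m ≤ N`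
  (exact cluster coefficients of the uniform gas + a one-pass induction on the level);
* `stub_eosCesaro` (E2b): telescoping `Ξ_N(N+1) = Π_m q_N(m)⁻¹`, matching with `hsFreeVolume`, and a Riemann sum
  give `−N⁻¹ log hsFreeVolume η N → ∫₀¹ log Rf(ηs) ds`;
* `stub_eosAssembly` (E3): `F(η) := ∫₀¹ log Rf(ηs) ds` is analytic near `0` with `F 0 = 0`, `F′(0) = 2π/3`, and
  equals the `limsup` defining `hsExcessFreeEnergy`.
-/

namespace Summit.AtomisticToContinuum.HydrodynamicLimit.Theorems

open Set Filter

/-- **The hard-sphere equation of state at low density** (`ImplosionDichotomy.HsEosLowDensity`,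
stmt-AtomisticToContinuum-0768): the excess free energy per particle of the hard-sphere gas is real-analytic at
small packing, vanishes at `0` with slope `2π/3`, and the canonical thermodynamic limit of `−N⁻¹ log hsFreeVolume`
exists there. Glue of the landed stubs E1, E2a, E2b, E3 of the line `log-lipschitz-budget`.
[cite: Ruelle1969, §3.4] -/
theorem hsEosLowDensity_proof :
    Summit.AtomisticToContinuum.HydrodynamicLimit.Theses.ImplosionDichotomy.HsEosLowDensity := by
  obtain ⟨r, hr, Rf, hps, h0, hd, hsol, hbd, hLip, -⟩ := stub_eosRatioAnalytic
  have hsol' : ∀ x ∈ Icc 0 (r / 2), 1 ≤ Rf x ∧ Rf x ≤ 2 ∧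
      Rf x * (∑' j : ℕ, Literature.MathematicalPhysics.KineticTheory.bE j / (j.factorial : ℝ) *
        (x * Rf x) ^ j) = 1 := by
    intro x hx
    have hx' : x ∈ Icc 0 r := ⟨hx.1, hx.2.trans (by linarith)⟩
    have hxo : x ∈ Ioo (-r) r := ⟨by linarith [hx.1], by linarith [hx.2]⟩
    exact ⟨(hbd x hx').1, (hbd x hx').2, (hsol x hxo).2⟩
  have hLip' : ∃ L : NNReal, LipschitzOnWith L Rf (Icc 0 (r / 2)) := by
    obtain ⟨L, hL⟩ := hLip
    exact ⟨L, hL.mono (Icc_subset_Icc le_rfl (by linarith))⟩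
  obtain ⟨η₂, hη₂, hη₂r, hunif⟩ := stub_eosRatioUniform Rf (r / 2) (by positivity) hsol' hLip'
  have hcont : ContinuousOn Rf (Icc 0 (r / 2)) := by
    obtain ⟨L, hL⟩ := hLip'
    exact hL.continuousOn
  have hbd' : ∀ x ∈ Icc 0 (r / 2), 1 ≤ Rf x ∧ Rf x ≤ 2 := fun x hx => ⟨(hsol' x hx).1, (hsol' x hx).2.1⟩
  have hlim : ∀ η ∈ Ico 0 η₂, Tendsto (fun N : ℕ => -(N : ℝ)⁻¹ *
      Real.log (Literature.MathematicalPhysics.KineticTheory.hsFreeVolume η N)) atTop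
      (nhds (∫ s in (0 : ℝ)..1, Real.log (Rf (η * s)))) := by
    intro η hη
    refine stub_eosCesaro Rf (r / 2) (by positivity) hcont hbd' h0 η hη.1 (hη.2.trans_le hη₂r) ?_
    intro hηpos δ hδ
    exact hunif η ⟨hηpos, hη.2⟩ δ hδ
  exact stub_eosAssembly Rf r hr hps h0 hd (fun x hx => (hsol x hx).1) η₂ hη₂ (hη₂r.trans (by linarith)) hlim

end Summit.AtomisticToContinuum.HydrodynamicLimit.Theorems
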